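import Mathlib
import Summits.Ventures.PercRepro2.ZMeanProof
import Summits.Ventures.PercRepro2.PendantRoot
import Summits.Ventures.PercRepro2.PocketTransport
import Summits.Ventures.PercRepro2.StarGlue

/-!
# The three-coin star at `a₃` (class O: `a₃` adjacent only to `a₁`, `a₂`, `o`): outcomes,
factorisation and the first mass identity (blind cell PercRepro2, night-1 g8; NIGHT1-G8.md §4)

1. OUTCOMES. With the star `{f₁, f₂, f₃}` (`ends f₁ = s(a₃,a₁)`, `ends f₂ = s(a₃,a₂)`,
   `ends f₃ = s(a₃,o)`) and `ω₁ = closeStar ends a₃ ω`, the glue lemma specialises outcome by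
   outcome: with at most one coin open, connections among vertices other than `a₃` are those of
   `ω₁` (`conn_iff_single`); with `f₁` and `f₃` open, `x ↔ y` iff `x ↔ y`, or `x ↔ a₁ ∧ o ↔ y`, or
   `x ↔ o ∧ a₁ ↔ y` in `ω₁` (`conn_iff_glue13`), and the mirror for `f₂, f₃`; the cluster of `a₃`
   on each outcome (`not_conn_a3_ccc`, `conn_a3_iff_f1`, `conn_a3_iff_f2`, `conn_a3_iff_o_of_f3`).
2. PROBABILITIES. The eight coin outcomes `outc b₁ b₂ b₃` partition the space
   (`prob_eq_sum_outc`); an event seen through the closed star (`viaStar A = {ω | closeStar ω ∈ A}`)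
   is free of every star edge, so on an outcome it factorises into the coin weights times its
   probability (`prob_inter_outc`), which is the probability of `A` under the star-zeroed weights
   `pOut` (`prob_viaStar`, PocketTransport).
3. THE FIRST MASS: `P(Q) = (1−α)(1−β)Z₁ + α(1−β)(Z₁ − rA_H) + β(1−α)(Z₁ − rA_L)` with
   `Z₁ = P_{pOut}(Q)`, `A_x = P_{pOut}(Q, o ∈ C_x)` (`prob_Q_star`) — the pattern for the remaining
   twelve masses of NIGHT1-G8.md §4 (`zMass` of StarOAlgebra).
Parts 2–3 are in `StarOProb.lean`; this file is part 1.
-/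

namespace Summit.Ventures.PercRepro2

open StarGlue PendantRoot


open StarGlue

namespace StarO

variable {V : Type*} {E : Type*}

variable {ends : E → Sym2 V} {f₁ f₂ f₃ : E} {a₃ a₁ a₂ o : V}

/-- A star edge at `a₃`, by `hstar`. -/
lemma star_edge (hstar : ∀ e, a₃ ∈ ends e → e = f₁ ∨ e = f₂ ∨ e = f₃) {e : E} {y : V}
    (h : ends e = s(a₃, y)) : e = f₁ ∨ e = f₂ ∨ e = f₃ :=
  hstar e (by rw [h]; exact Sym2.mem_mk_left _ _)

/-- The other end of a star edge whose ends are `s(a₃, m)`. -/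
lemma end_eq_of_ends_eq {m y : V} (hy : a₃ ≠ y) (h : s(a₃, y) = s(a₃, m)) : m = y := by
  rcases Sym2.eq_iff.1 h with ⟨_, h'⟩ | ⟨h', h''⟩
  · exact h'.symm
  · exact absurd h''.symm hy

/-- **The open neighbours of `a₃`** on the three-coin star. -/
theorem openAdj_a3_iff (hf₁ : ends f₁ = s(a₃, a₁)) (hf₂ : ends f₂ = s(a₃, a₂))
    (hf₃ : ends f₃ = s(a₃, o)) (hstar : ∀ e, a₃ ∈ ends e → e = f₁ ∨ e = f₂ ∨ e = f₃)
    (h31 : a₃ ≠ a₁) (h32 : a₃ ≠ a₂) (h3o : a₃ ≠ o) {ω : Config E} {m : V} :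
    OpenAdj ends ω a₃ m ↔
      (ω f₁ = true ∧ m = a₁) ∨ (ω f₂ = true ∧ m = a₂) ∨ (ω f₃ = true ∧ m = o) := by
  constructor
  · rintro ⟨e, he, hends⟩
    rcases star_edge hstar hends with rfl | rfl | rfl
    · exact Or.inl ⟨he, end_eq_of_ends_eq h31 (hf₁.symm.trans hends)⟩
    · exact Or.inr (Or.inl ⟨he, end_eq_of_ends_eq h32 (hf₂.symm.trans hends)⟩)
    · exact Or.inr (Or.inr ⟨he, end_eq_of_ends_eq h3o (hf₃.symm.trans hends)⟩)
  · rintro (⟨he, rfl⟩ | ⟨he, rfl⟩ | ⟨he, rfl⟩)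
    · exact ⟨f₁, he, hf₁⟩
    · exact ⟨f₂, he, hf₂⟩
    · exact ⟨f₃, he, hf₃⟩

/-- With the `o`-coin open, `a₃ ↔ o`. -/
theorem conn_a3_o_of_f3 (hf₃ : ends f₃ = s(a₃, o)) {ω : Config E} (h3 : ω f₃ = true) :
    Conn ends ω a₃ o :=
  conn_of_openAdj ⟨f₃, h3, hf₃⟩

/-- With the `o`-coin open, `a₃ ↔ y` iff `o ↔ y` (any `y`). -/
theorem conn_a3_iff_o_of_f3 (hf₃ : ends f₃ = s(a₃, o)) {ω : Config E} (h3 : ω f₃ = true)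
    (y : V) : Conn ends ω a₃ y ↔ Conn ends ω o y :=
  ⟨fun h => conn_trans (conn_symm (conn_a3_o_of_f3 hf₃ h3)) h,
    fun h => conn_trans (conn_a3_o_of_f3 hf₃ h3) h⟩

section Outcomes

variable [DecidablePred (· ∈ (touches ends {a₃})ᶜ)]

/-- Outcomes with at most one coin open: connections among vertices other than `a₃` are those of
the star-closed configuration (a single glued vertex is a pendant). -/
theorem conn_iff_single (hf₁ : ends f₁ = s(a₃, a₁)) (hf₂ : ends f₂ = s(a₃, a₂))
    (hf₃ : ends f₃ = s(a₃, o)) (hstar : ∀ e, a₃ ∈ ends e → e = f₁ ∨ e = f₂ ∨ e = f₃)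
    (h31 : a₃ ≠ a₁) (h32 : a₃ ≠ a₂) (h3o : a₃ ≠ o) {ω : Config E}
    (h12 : ¬ (ω f₁ = true ∧ ω f₂ = true)) (h13 : ¬ (ω f₁ = true ∧ ω f₃ = true))
    (h23 : ¬ (ω f₂ = true ∧ ω f₃ = true)) {x y : V} (hx : x ≠ a₃)
    (hy : y ≠ a₃) : Conn ends ω x y ↔ Conn ends (closeStar ends a₃ ω) x y := by
  rw [conn_iff_glue hx hy]
  constructor
  · rintro (h | ⟨⟨m, hm, hxm⟩, ⟨m', hm', hmy⟩⟩)
    · exact h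
    · rw [openAdj_a3_iff hf₁ hf₂ hf₃ hstar h31 h32 h3o] at hm hm'
      have hmm : m = m' := by
        rcases hm with ⟨h1, rfl⟩ | ⟨h2, rfl⟩ | ⟨h3, rfl⟩ <;>
          rcases hm' with ⟨h1', rfl⟩ | ⟨h2', rfl⟩ | ⟨h3', rfl⟩
        · rfl
        · exact absurd ⟨h1, h2'⟩ h12
        · exact absurd ⟨h1, h3'⟩ h13
        · exact absurd ⟨h1', h2⟩ h12
        · rfl
        · exact absurd ⟨h2, h3'⟩ h23
        · exact absurd ⟨h1', h3⟩ h13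
        · exact absurd ⟨h2', h3⟩ h23
        · rfl
      subst hmm
      exact conn_trans hxm hmy
  · exact fun h => Or.inl h

/-- `f₁` and `f₃` open, `f₂` closed: `a₁` and `o` are glued. -/
theorem conn_iff_glue13 (hf₁ : ends f₁ = s(a₃, a₁)) (hf₂ : ends f₂ = s(a₃, a₂))
    (hf₃ : ends f₃ = s(a₃, o)) (hstar : ∀ e, a₃ ∈ ends e → e = f₁ ∨ e = f₂ ∨ e = f₃)
    (h31 : a₃ ≠ a₁) (h32 : a₃ ≠ a₂) (h3o : a₃ ≠ o) {ω : Config E}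
    (h1 : ω f₁ = true) (h2 : ω f₂ = false) (h3 : ω f₃ = true) {x y : V} (hx : x ≠ a₃)
    (hy : y ≠ a₃) :
    Conn ends ω x y ↔ Conn ends (closeStar ends a₃ ω) x y ∨
      (Conn ends (closeStar ends a₃ ω) x a₁ ∧ Conn ends (closeStar ends a₃ ω) o y) ∨
      (Conn ends (closeStar ends a₃ ω) x o ∧ Conn ends (closeStar ends a₃ ω) a₁ y) := by
  rw [conn_iff_glue hx hy]
  have hnb : ∀ m, OpenAdj ends ω a₃ m ↔ m = a₁ ∨ m = o := by
    intro m
    rw [openAdj_a3_iff hf₁ hf₂ hf₃ hstar h31 h32 h3o]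
    constructor
    · rintro (⟨_, rfl⟩ | ⟨h2', _⟩ | ⟨_, rfl⟩)
      · exact Or.inl rfl
      · rw [h2] at h2'; exact absurd h2' Bool.false_ne_true
      · exact Or.inr rfl
    · rintro (rfl | rfl)
      · exact Or.inl ⟨h1, rfl⟩
      · exact Or.inr (Or.inr ⟨h3, rfl⟩)
  constructor
  · rintro (h | ⟨⟨m, hm, hxm⟩, ⟨m', hm', hmy⟩⟩)
    · exact Or.inl h
    · rw [hnb] at hm hm'
      rcases hm with rfl | rfl <;> rcases hm' with rfl | rfl
      · exact Or.inl (conn_trans hxm hmy)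
      · exact Or.inr (Or.inl ⟨hxm, hmy⟩)
      · exact Or.inr (Or.inr ⟨hxm, hmy⟩)
      · exact Or.inl (conn_trans hxm hmy)
  · rintro (h | ⟨hxa, hoy⟩ | ⟨hxo, hay⟩)
    · exact Or.inl h
    · exact Or.inr ⟨⟨a₁, (hnb a₁).2 (Or.inl rfl), hxa⟩, ⟨o, (hnb o).2 (Or.inr rfl), hoy⟩⟩
    · exact Or.inr ⟨⟨o, (hnb o).2 (Or.inr rfl), hxo⟩, ⟨a₁, (hnb a₁).2 (Or.inl rfl), hay⟩⟩

/-- `f₂` and `f₃` open, `f₁` closed: `a₂` and `o` are glued. -/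
theorem conn_iff_glue23 (hf₁ : ends f₁ = s(a₃, a₁)) (hf₂ : ends f₂ = s(a₃, a₂))
    (hf₃ : ends f₃ = s(a₃, o)) (hstar : ∀ e, a₃ ∈ ends e → e = f₁ ∨ e = f₂ ∨ e = f₃)
    (h31 : a₃ ≠ a₁) (h32 : a₃ ≠ a₂) (h3o : a₃ ≠ o) {ω : Config E}
    (h1 : ω f₁ = false) (h2 : ω f₂ = true) (h3 : ω f₃ = true) {x y : V} (hx : x ≠ a₃)
    (hy : y ≠ a₃) :
    Conn ends ω x y ↔ Conn ends (closeStar ends a₃ ω) x y ∨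
      (Conn ends (closeStar ends a₃ ω) x a₂ ∧ Conn ends (closeStar ends a₃ ω) o y) ∨
      (Conn ends (closeStar ends a₃ ω) x o ∧ Conn ends (closeStar ends a₃ ω) a₂ y) := by
  rw [conn_iff_glue hx hy]
  have hnb : ∀ m, OpenAdj ends ω a₃ m ↔ m = a₂ ∨ m = o := by
    intro m
    rw [openAdj_a3_iff hf₁ hf₂ hf₃ hstar h31 h32 h3o]
    constructor
    · rintro (⟨h1', _⟩ | ⟨_, rfl⟩ | ⟨_, rfl⟩)
      · rw [h1] at h1'; exact absurd h1' Bool.false_ne_true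
      · exact Or.inl rfl
      · exact Or.inr rfl
    · rintro (rfl | rfl)
      · exact Or.inr (Or.inl ⟨h2, rfl⟩)
      · exact Or.inr (Or.inr ⟨h3, rfl⟩)
  constructor
  · rintro (h | ⟨⟨m, hm, hxm⟩, ⟨m', hm', hmy⟩⟩)
    · exact Or.inl h
    · rw [hnb] at hm hm'
      rcases hm with rfl | rfl <;> rcases hm' with rfl | rfl
      · exact Or.inl (conn_trans hxm hmy)
      · exact Or.inr (Or.inl ⟨hxm, hmy⟩)
      · exact Or.inr (Or.inr ⟨hxm, hmy⟩)
      · exact Or.inl (conn_trans hxm hmy)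
  · rintro (h | ⟨hxa, hoy⟩ | ⟨hxo, hay⟩)
    · exact Or.inl h
    · exact Or.inr ⟨⟨a₂, (hnb a₂).2 (Or.inl rfl), hxa⟩, ⟨o, (hnb o).2 (Or.inr rfl), hoy⟩⟩
    · exact Or.inr ⟨⟨o, (hnb o).2 (Or.inr rfl), hxo⟩, ⟨a₂, (hnb a₂).2 (Or.inl rfl), hay⟩⟩

/-- The cluster of `a₃` with every coin closed: isolated. -/
theorem not_conn_a3_ccc (hf₁ : ends f₁ = s(a₃, a₁)) (hf₂ : ends f₂ = s(a₃, a₂))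
    (hf₃ : ends f₃ = s(a₃, o)) (hstar : ∀ e, a₃ ∈ ends e → e = f₁ ∨ e = f₂ ∨ e = f₃)
    (h31 : a₃ ≠ a₁) (h32 : a₃ ≠ a₂) (h3o : a₃ ≠ o) {ω : Config E}
    (h1 : ω f₁ = false) (h2 : ω f₂ = false) (h3 : ω f₃ = false) {y : V} (hy : y ≠ a₃) :
    ¬ Conn ends ω a₃ y := by
  rw [conn_a3_iff_glue hy]
  rintro ⟨m, hm, _⟩
  rw [openAdj_a3_iff hf₁ hf₂ hf₃ hstar h31 h32 h3o] at hm
  rcases hm with ⟨h, _⟩ | ⟨h, _⟩ | ⟨h, _⟩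
  · rw [h1] at h; exact Bool.false_ne_true h
  · rw [h2] at h; exact Bool.false_ne_true h
  · rw [h3] at h; exact Bool.false_ne_true h

/-- The cluster of `a₃` with only `f₂` open: the star-closed cluster of `a₂`. -/
theorem conn_a3_iff_f2 (hf₁ : ends f₁ = s(a₃, a₁)) (hf₂ : ends f₂ = s(a₃, a₂))
    (hf₃ : ends f₃ = s(a₃, o)) (hstar : ∀ e, a₃ ∈ ends e → e = f₁ ∨ e = f₂ ∨ e = f₃)
    (h31 : a₃ ≠ a₁) (h32 : a₃ ≠ a₂) (h3o : a₃ ≠ o) {ω : Config E}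
    (h1 : ω f₁ = false) (h2 : ω f₂ = true) (h3 : ω f₃ = false) {y : V} (hy : y ≠ a₃) :
    Conn ends ω a₃ y ↔ Conn ends (closeStar ends a₃ ω) a₂ y := by
  rw [conn_a3_iff_glue hy]
  constructor
  · rintro ⟨m, hm, hmy⟩
    rw [openAdj_a3_iff hf₁ hf₂ hf₃ hstar h31 h32 h3o] at hm
    rcases hm with ⟨h, _⟩ | ⟨_, rfl⟩ | ⟨h, _⟩
    · rw [h1] at h; exact absurd h Bool.false_ne_true
    · exact hmy
    · rw [h3] at h; exact absurd h Bool.false_ne_true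
  · intro h
    exact ⟨a₂, (openAdj_a3_iff hf₁ hf₂ hf₃ hstar h31 h32 h3o).2 (Or.inr (Or.inl ⟨h2, rfl⟩)), h⟩

/-- The cluster of `a₃` with only `f₁` open: the star-closed cluster of `a₁`. -/
theorem conn_a3_iff_f1 (hf₁ : ends f₁ = s(a₃, a₁)) (hf₂ : ends f₂ = s(a₃, a₂))
    (hf₃ : ends f₃ = s(a₃, o)) (hstar : ∀ e, a₃ ∈ ends e → e = f₁ ∨ e = f₂ ∨ e = f₃)
    (h31 : a₃ ≠ a₁) (h32 : a₃ ≠ a₂) (h3o : a₃ ≠ o) {ω : Config E}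
    (h1 : ω f₁ = true) (h2 : ω f₂ = false) (h3 : ω f₃ = false) {y : V} (hy : y ≠ a₃) :
    Conn ends ω a₃ y ↔ Conn ends (closeStar ends a₃ ω) a₁ y := by
  rw [conn_a3_iff_glue hy]
  constructor
  · rintro ⟨m, hm, hmy⟩
    rw [openAdj_a3_iff hf₁ hf₂ hf₃ hstar h31 h32 h3o] at hm
    rcases hm with ⟨_, rfl⟩ | ⟨h, _⟩ | ⟨h, _⟩
    · exact hmy
    · rw [h2] at h; exact absurd h Bool.false_ne_true
    · rw [h3] at h; exact absurd h Bool.false_ne_true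
  · intro h
    exact ⟨a₁, (openAdj_a3_iff hf₁ hf₂ hf₃ hstar h31 h32 h3o).2 (Or.inl ⟨h1, rfl⟩), h⟩

end Outcomes

end StarO



open StarGlue PendantRoot


end Summit.Ventures.PercRepro2
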